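import Literature.Geometry.Lorentzian.BilinPullbackEstimates
import Mathlib.Topology.UniformSpace.HeineCantor
import HarnessLib

/-!
# Route ClusterCompleteness · crux `OmegaLimitMultiKerr` — the concrete KILLING-DEFECT FLUX:
# continuity along `C¹`-convergent sequences, definiteness, nonnegativity, continuity in time

Structure lemma for the crux stmt-FinalStateConjecture-14664
(`ClusterCompleteness.OmegaLimitMultiKerr`, rank 9), line `Sketch`, lead gen 5. The headline of the
LaSalle / ω-limit line (`tendsto_supCkENorm_fderiv_translate_of_transfer`) reads: TAMENESS plus a
TRANSFER inequality for a family of local fluxes `Φ_K` of the chart field which are (i) continuous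
along `C¹`-convergent sequences, (ii) DEFINITE for `∂ₑ` (`Φ_K g = 0 ⇒ ∂ₑ g = 0` on `K`),
(iii) nonnegative and (iv) continuous along the translates `s ↦ Φ_K (g (· + s • e))`, forces the
development to be asymptotically stationary. This file supplies the CONCRETE flux

  `Φ_K f := sup_{x ∈ K} min (1, ‖Df(x) e‖) = sSup ((fun x ↦ min 1 ‖fderiv ℝ f x e‖) '' K)`

("Killing-defect flux": the truncated size, over the compact `K`, of the derivative of the chart
field along the background's Killing translation `e`; the truncation `min 1 ·` keeps it bounded, so
that the real `sSup` is an honest supremum on every nonempty `K`), together with the four properties: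

* `tendsto_sSup_min_norm_fderiv_apply_of_tendsto_supCkENorm` (the registered stub, closed form) —
  (i): if `f n → g` in `C^{k+1}(K)` (`supCkENorm K (k + 1) (f n − g) → 0`), all `C¹` on an open
  `O ⊇ K`, then `Φ_K (f n) → Φ_K g`. Indeed `‖D(f n)(x) − Dg(x)‖ = ‖D¹(f n − g)(x)‖` is eventually
  uniformly small on `K`, `t ↦ min 1 t` is `1`-Lipschitz and `‖L e‖ − ‖M e‖ ≤ ‖L − M‖ ‖e‖`, and two
  pointwise `η`-close bounded families have `η`-close suprema;
* `fderiv_apply_eq_zero_of_sSup_min_norm_fderiv_apply_eq_zero` — (ii): `Φ_K g = 0 ⇒ Dg(x) e = 0`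
  for `x ∈ K` (each `min (1, ‖Dg(x) e‖) ≤ Φ_K g = 0`);
* `sSup_min_norm_fderiv_apply_nonneg` — (iii): `0 ≤ Φ_K g`;
* `continuous_sSup_min_norm_fderiv_apply_translate` — (iv): for `g ∈ C¹(O)`, `O` open and
  invariant under `x ↦ x + s • e`, `K ⊆ O` compact, `s ↦ Φ_K (g (· + s • e))` is continuous
  (`D[g (· + s • e)](x) = Dg (x + s • e)`, and `Dg` is uniformly continuous near the compact
  `K + s₀ • e`, Heine–Cantor).

Everything is proved; Mathlib + `Literature` only; no definitions (the flux is written out each time).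
-/

-- every `Summit.FinalStateConjecture.FinalStateConjecture.…` name repeats the summit = sub-problem segment (D-0017 layout)
set_option linter.dupNamespace false

noncomputable section

open Set Filter Topology Function
open scoped ContDiff Topology ENNReal

namespace Summit.FinalStateConjecture.FinalStateConjecture.Theorems.ClusterCompleteness

open Literature.Geometry.Lorentzian

section Bookkeeping

variable {E : Type*} [NormedAddCommGroup E] [NormedSpace ℝ E]
  {W : Type*} [NormedAddCommGroup W] [NormedSpace ℝ W]

/-- Suprema of pointwise `η`-close real families over a nonempty index set, both bounded above, are
`η`-close: `|sup_S u − sup_S v| ≤ η` if `|u x − v x| ≤ η` on `S`. [folklore] -/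
private theorem abs_sSup_image_sub_sSup_image_le_of_forall {α : Type*} {S : Set α}
    (hS : S.Nonempty) {u v : α → ℝ} (hu : BddAbove (u '' S)) (hv : BddAbove (v '' S)) {η : ℝ}
    (h : ∀ x ∈ S, |u x - v x| ≤ η) : |sSup (u '' S) - sSup (v '' S)| ≤ η := by
  refine abs_sub_le_iff.2 ⟨?_, ?_⟩
  · rw [sub_le_iff_le_add]
    refine csSup_le (hS.image u) (forall_mem_image.2 fun x hx ↦ ?_)
    have h1 := (abs_sub_le_iff.1 (h x hx)).1
    have h2 := le_csSup hv (mem_image_of_mem v hx)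
    linarith
  · rw [sub_le_iff_le_add]
    refine csSup_le (hS.image v) (forall_mem_image.2 fun x hx ↦ ?_)
    have h1 := (abs_sub_le_iff.1 (h x hx)).2
    have h2 := le_csSup hu (mem_image_of_mem u hx)
    linarith

/-- The truncated evaluation `L ↦ min (1, ‖L e‖)` is `‖e‖`-Lipschitz in the operator norm:
`|min (1, ‖L e‖) − min (1, ‖M e‖)| ≤ ‖L − M‖ ‖e‖`. [folklore] -/
private theorem abs_min_one_norm_apply_sub_min_one_norm_apply_le (L M : E →L[ℝ] W) (e : E) :
    |min 1 ‖L e‖ - min 1 ‖M e‖| ≤ ‖L - M‖ * ‖e‖ :=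
  calc |min 1 ‖L e‖ - min 1 ‖M e‖|
      ≤ max |(1 : ℝ) - 1| |‖L e‖ - ‖M e‖| := abs_min_sub_min_le_max _ _ _ _
    _ = |‖L e‖ - ‖M e‖| := by rw [sub_self, abs_zero, max_eq_right (abs_nonneg _)]
    _ ≤ ‖L e - M e‖ := abs_norm_sub_norm_le _ _
    _ = ‖(L - M) e‖ := by rw [sub_apply]
    _ ≤ ‖L - M‖ * ‖e‖ := (L - M).le_opNorm e

/-- The images of the truncated fluxes are bounded above by `1`. [folklore] -/
private theorem bddAbove_image_min_one {α : Type*} (u : α → ℝ) (S : Set α) :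
    BddAbove ((fun x ↦ min 1 (u x)) '' S) :=
  ⟨1, forall_mem_image.2 fun _ _ ↦ min_le_left _ _⟩

/-- From a `C^{k+1}` sup-norm bound on `F − G` over `K` to a uniform bound on `DF − DG` over `K`:
for `F, G ∈ C¹(O)`, `O` open, `K ⊆ O`, if `supCkENorm K (k + 1) (F − G) < δ` then
`‖DF(x) − DG(x)‖ < δ` for `x ∈ K` (`DF(x) − DG(x) = D¹(F − G)(x)`, an entry of the sup norm).
[folklore] -/
private theorem norm_fderiv_sub_fderiv_lt_of_supCkENorm_sub_lt {O K : Set E} {k : ℕ}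
    {F G : E → W} (hO : IsOpen O) (hKO : K ⊆ O) (hF : ContDiffOn ℝ 1 F O)
    (hG : ContDiffOn ℝ 1 G O) {δ : ℝ} (hδ : 0 < δ)
    (hlt : supCkENorm K (k + 1) (fun x ↦ F x - G x) < ENNReal.ofReal δ) {x : E} (hx : x ∈ K) :
    ‖fderiv ℝ F x - fderiv ℝ G x‖ < δ := by
  have hxO : O ∈ 𝓝 x := hO.mem_nhds (hKO hx)
  have hFx : DifferentiableAt ℝ F x := (hF.differentiableOn one_ne_zero).differentiableAt hxO
  have hGx : DifferentiableAt ℝ G x := (hG.differentiableOn one_ne_zero).differentiableAt hxO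
  rw [← fderiv_fun_sub hFx hGx, ← norm_iteratedFDeriv_one, ← ENNReal.ofReal_lt_ofReal_iff hδ,
    ofReal_norm]
  exact (enorm_iteratedFDeriv_le_supCkENorm (Nat.le_add_left 1 k) hx _).trans_lt hlt

end Bookkeeping

/-- **Registered structure stub (crux stmt-FinalStateConjecture-14664, line `Sketch`): the
Killing-defect flux is continuous along `C¹`-convergent sequences.** Let `O` be open, `K ⊆ O`
compact, `f n, g ∈ C¹(O)` with `supCkENorm K (k + 1) (f n − g) → 0`. Then
`sup_{x ∈ K} min (1, ‖D(f n)(x) e‖) → sup_{x ∈ K} min (1, ‖Dg(x) e‖)`.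
Proof: eventually `‖D(f n)(x) − Dg(x)‖ = ‖D¹(f n − g)(x)‖ < δ` uniformly on `K`, so the truncated
fluxes are pointwise `δ ‖e‖`-close on `K` (`min (1, ·)` is `1`-Lipschitz,
`|‖L e‖ − ‖M e‖| ≤ ‖L − M‖ ‖e‖`), hence so are their (bounded, `K ≠ ∅`) suprema; `K = ∅` is the
constant sequence. Closed form. [folklore] -/
theorem tendsto_sSup_min_norm_fderiv_apply_of_tendsto_supCkENorm :
    ∀ {E : Type*} [NormedAddCommGroup E] [NormedSpace ℝ E]
      {W : Type*} [NormedAddCommGroup W] [NormedSpace ℝ W]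
      {O K : Set E} {e : E} {k : ℕ} {f : ℕ → E → W} {g : E → W},
      IsOpen O → K ⊆ O → IsCompact K → (∀ n, ContDiffOn ℝ 1 (f n) O) → ContDiffOn ℝ 1 g O →
      Tendsto (fun n ↦ supCkENorm K (k + 1) (fun x ↦ f n x - g x)) atTop (𝓝 0) →
      Tendsto (fun n ↦ sSup ((fun x ↦ min 1 ‖fderiv ℝ (f n) x e‖) '' K)) atTop
        (𝓝 (sSup ((fun x ↦ min 1 ‖fderiv ℝ g x e‖) '' K))) := by
  intro E _ _ W _ _ O K e k f g hO hKO _ hf hg hconv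
  rcases K.eq_empty_or_nonempty with rfl | hKne
  · simp only [image_empty]
    exact tendsto_const_nhds
  refine Metric.tendsto_nhds.2 fun ε hε ↦ ?_
  have hc : 0 < ‖e‖ + 1 := by positivity
  have hδ : 0 < ε / 2 / (‖e‖ + 1) := by positivity
  -- eventually the `C^{k+1}` distance is `< δ`
  have hev : ∀ᶠ n in atTop,
      supCkENorm K (k + 1) (fun x ↦ f n x - g x) < ENNReal.ofReal (ε / 2 / (‖e‖ + 1)) :=
    hconv.eventually_lt_const (ENNReal.ofReal_pos.2 hδ)
  filter_upwards [hev] with n hn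
  rw [Real.dist_eq]
  calc |sSup ((fun x ↦ min 1 ‖fderiv ℝ (f n) x e‖) '' K) -
        sSup ((fun x ↦ min 1 ‖fderiv ℝ g x e‖) '' K)|
      ≤ ε / 2 / (‖e‖ + 1) * (‖e‖ + 1) :=
        abs_sSup_image_sub_sSup_image_le_of_forall hKne (bddAbove_image_min_one _ K)
          (bddAbove_image_min_one _ K) fun x hx ↦
          (abs_min_one_norm_apply_sub_min_one_norm_apply_le _ _ e).trans
            (mul_le_mul
              (norm_fderiv_sub_fderiv_lt_of_supCkENorm_sub_lt hO hKO (hf n) hg hδ hn hx).le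
              (lt_add_one _).le (norm_nonneg _) hδ.le)
    _ = ε / 2 := div_mul_cancel₀ _ hc.ne'
    _ < ε := half_lt_self hε

section Riders

variable {E : Type*} [NormedAddCommGroup E] [NormedSpace ℝ E]
  {W : Type*} [NormedAddCommGroup W] [NormedSpace ℝ W]

/-- **Definiteness of the Killing-defect flux for `∂ₑ`.** If `sup_{x ∈ K} min (1, ‖Dg(x) e‖) = 0`
then `Dg(x) e = 0` for every `x ∈ K`: each `min (1, ‖Dg(x) e‖)` is `≤` the (bounded) supremum
`= 0`, and `min (1, t) ≤ 0` with `t ≥ 0` forces `t = 0`. [folklore] -/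
theorem fderiv_apply_eq_zero_of_sSup_min_norm_fderiv_apply_eq_zero {K : Set E} {e : E}
    {g : E → W} (h0 : sSup ((fun x ↦ min 1 ‖fderiv ℝ g x e‖) '' K) = 0) :
    ∀ x ∈ K, fderiv ℝ g x e = 0 := by
  intro x hx
  have hle : min 1 ‖fderiv ℝ g x e‖ ≤ 0 :=
    (le_csSup (bddAbove_image_min_one _ K) (mem_image_of_mem _ hx)).trans_eq h0
  rcases min_le_iff.1 hle with h1 | h1
  · exact absurd h1 (not_le.2 zero_lt_one)
  · exact norm_le_zero_iff.1 h1

/-- **Nonnegativity of the Killing-defect flux**: `0 ≤ sup_{x ∈ K} min (1, ‖Dg(x) e‖)` (all entries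
are `≥ 0`; the empty supremum is `0`). [folklore] -/
theorem sSup_min_norm_fderiv_apply_nonneg {K : Set E} {e : E} {g : E → W} :
    0 ≤ sSup ((fun x ↦ min 1 ‖fderiv ℝ g x e‖) '' K) :=
  Real.sSup_nonneg (forall_mem_image.2 fun _ _ ↦ le_min zero_le_one (norm_nonneg _))

/-- **Continuity of the Killing-defect flux along translates.** Let `O` be open and invariant under
all translations `x ↦ x + s • e`, `K ⊆ O` compact, `g ∈ C¹(O)`. Then
`s ↦ sup_{x ∈ K} min (1, ‖D[g (· + s • e)](x) e‖)` is continuous: `D[g (· + s • e)](x) = Dg(x + s • e)`,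
and `Dg`, continuous on `O`, is uniformly continuous at the compact translate `K + s₀ • e ⊆ O`
(Heine–Cantor), so the truncated fluxes at `s` and `s₀` are pointwise, hence in supremum, close for
`s` near `s₀`. [folklore] -/
theorem continuous_sSup_min_norm_fderiv_apply_translate {O K : Set E} {e : E} (hO : IsOpen O)
    (hOe : ∀ x ∈ O, ∀ s : ℝ, x + s • e ∈ O) (hKO : K ⊆ O) (hK : IsCompact K) {g : E → W}
    (hg : ContDiffOn ℝ 1 g O) :
    Continuous fun s : ℝ ↦ sSup ((fun x ↦ min 1 ‖fderiv ℝ (fun y ↦ g (y + s • e)) x e‖) '' K) := by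
  simp only [fderiv_comp_add_right]
  rcases K.eq_empty_or_nonempty with rfl | hKne
  · simp only [image_empty]
    exact continuous_const
  have hcont : ContinuousOn (fderiv ℝ g) O := hg.continuousOn_fderiv_of_isOpen hO le_rfl
  have hc : 0 < ‖e‖ + 1 := by positivity
  refine continuous_iff_continuousAt.2 fun s₀ ↦ Metric.continuousAt_iff'.2 fun ε hε ↦ ?_
  have hη : 0 < ε / 2 / (‖e‖ + 1) := by positivity
  -- `Dg` is uniformly continuous at the compact translate `K + s₀ • e ⊆ O`
  have hK' : IsCompact ((fun x ↦ x + s₀ • e) '' K) := hK.image (continuous_id.add continuous_const)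
  have hK'c : ∀ a ∈ (fun x ↦ x + s₀ • e) '' K, ContinuousAt (fderiv ℝ g) a := by
    rintro _ ⟨x, hx, rfl⟩
    exact hcont.continuousAt (hO.mem_nhds (hOe x (hKO hx) s₀))
  obtain ⟨θ, hθ, hθU⟩ := Metric.mem_uniformity_dist.1
    (hK'.uniformContinuousAt_of_continuousAt (fderiv ℝ g) hK'c (Metric.dist_mem_uniformity hη))
  have hθ' : 0 < θ / (‖e‖ + 1) := by positivity
  refine Metric.eventually_nhds_iff.2 ⟨θ / (‖e‖ + 1), hθ', fun s hs ↦ ?_⟩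
  -- pointwise closeness of the derivatives along `K`
  have hpt : ∀ x ∈ K,
      ‖fderiv ℝ g (x + s • e) - fderiv ℝ g (x + s₀ • e)‖ < ε / 2 / (‖e‖ + 1) := by
    intro x hx
    have hd : dist (x + s₀ • e) (x + s • e) < θ := by
      rw [dist_eq_norm, add_sub_add_left_eq_sub, ← sub_smul, norm_smul, Real.norm_eq_abs,
        abs_sub_comm]
      rw [Real.dist_eq] at hs
      calc |s - s₀| * ‖e‖ ≤ |s - s₀| * (‖e‖ + 1) :=
            mul_le_mul_of_nonneg_left (lt_add_one _).le (abs_nonneg _)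
        _ < θ / (‖e‖ + 1) * (‖e‖ + 1) := mul_lt_mul_of_pos_right hs hc
        _ = θ := div_mul_cancel₀ _ hc.ne'
    have h : dist (fderiv ℝ g (x + s₀ • e)) (fderiv ℝ g (x + s • e)) < ε / 2 / (‖e‖ + 1) :=
      hθU hd (mem_image_of_mem _ hx)
    rwa [dist_comm, dist_eq_norm] at h
  rw [Real.dist_eq]
  calc |sSup ((fun x ↦ min 1 ‖fderiv ℝ g (x + s • e) e‖) '' K) -
        sSup ((fun x ↦ min 1 ‖fderiv ℝ g (x + s₀ • e) e‖) '' K)|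
      ≤ ε / 2 / (‖e‖ + 1) * (‖e‖ + 1) :=
        abs_sSup_image_sub_sSup_image_le_of_forall hKne (bddAbove_image_min_one _ K)
          (bddAbove_image_min_one _ K) fun x hx ↦
          (abs_min_one_norm_apply_sub_min_one_norm_apply_le _ _ e).trans
            (mul_le_mul (hpt x hx).le (lt_add_one _).le (norm_nonneg _) hη.le)
    _ = ε / 2 := div_mul_cancel₀ _ hc.ne'
    _ < ε := half_lt_self hε

end Riders

end Summit.FinalStateConjecture.FinalStateConjecture.Theorems.ClusterCompleteness

end
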